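import Literature.NumberTheory.LFunctions.GranvilleMollinLinnikFromDHDensity
import Literature.NumberTheory.LFunctions.TwistedLogFreeDensityMotohashi
import HarnessLib

/-!
# "Theorem J" (the low-height log-free density estimate with the Deuring–Heilbronn factor, in
# `q`-units, ALL ranges of `β₁`) from Motohashi's twisted density estimate — and hence
# Granville–Mollin (3.3)

Topic `Literature/NumberTheory/LFunctions`, namespace `SiegelZero`. THEOREMS only (no named fact is
introduced). Typed for the cell `landau-siegel` (F-S3 §C, reader r3; START-HERE SH-059 "Theorem J
exponent gap", rows r3-P32/T25/T26/OQ14).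

`SiegelZero.GranvilleMollin2000_eq33_of_dhDensity` (`GranvilleMollinLinnikFromDHDensity.lean`) reduces
Granville–Mollin (3.3) to the hypothesis "Theorem J": constants `λ* > 0`, `0 < θ₁ ≤ 1`, `0 ≤ a < 9`,
`K_J`, `q_J` with `N(α, q^{θ₁}; χ, {β₁}) ≤ K_J ((1 − β₁) log q) q^{a(1−α)}` for every primitive quadratic
`χ` mod `q ≥ q_J`, every real zero `β₁ ≥ 1 − λ*/log q` and every `1/2 ≤ α ≤ 1`.
`DHDensityModerate.lean` proves this shape (with `a = 7`) only in the moderate range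
`C_r/(log q)⁵ ≤ (1 − β₁) log q ≤ c_l`, and names Jutila 1977 / Motohashi 1977 for the rest. Here we
derive Theorem J for ALL `β₁ ≥ 1 − λ*/log q` — with `θ₁ = 1/1000`, `a = 89/10` — from the named fact
`motohashi1977_theoremII` (`TwistedLogFreeDensityMotohashi.lean`, Motohashi, Proc. Japan Acad. 53A
(1977), the Theorem, `χ = χ₁` term) and two inputs already PROVED in the tree:

* for `19/20 ≤ α ≤ 1`: Motohashi at `T = q^{θ₁}`, `ε = 1/100`:
  `N ≤ C (1 − β₁) log(q^{1+θ₁}) (q^{7+4θ₁})^{(1+ε)(1−α)/(3α−2)} ≤ C(1+θ₁)((1−β₁)log q) q^{a(1−α)}`,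
  because `(7 + 4θ₁)(1 + ε)/(3α − 2) ≤ 7.07404/0.85 < 89/10`;
* for `1/2 ≤ α < 19/20`: the trivial count `N(q^{θ₁}, χ) ≤ C₀ q^{θ₁} log q`
  (`SiegelZero.exists_boxCount_le_of_le`, MV Thm 10.17) and Siegel's theorem
  `1 − β₁ ≥ C_S q^{−1/40}` (`Siegel.exists_one_sub_realZero_ge`, ineffective — as (3.3) itself):
  `C₀ q^{θ₁} log q ≤ (C₀/C_S)((1 − β₁) log q) q^{θ₁ + 1/40} ≤ K_J ((1 − β₁) log q) q^{a(1−α)}` since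
  `a(1 − α) > 89/200 > θ₁ + 1/40`.

Consequently `GranvilleMollin2000_eq33` (Granville–Mollin, Acta Arith. 96 (2000), (3.3)) holds
conditionally on the single printed input `motohashi1977_theoremII` (`GranvilleMollin2000_eq33_of_motohashi`).
No claim about Landau–Siegel zeros is made; the constants are ineffective (Siegel).

«The programme SEARCHES and TYPES; no claim about Landau–Siegel zeros, Theorems 1–2 of
arXiv:2211.02515 or a repaired Margin232 until a kernel theorem says so.»

## References

* Y. Motohashi, *On the Deuring–Heilbronn phenomenon, II*, Proc. Japan Acad. 53A (1977) 25–27.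
  [Motohashi1977DeuringHeilbronnII]
* A. Granville, R. A. Mollin, *Rabinowitsch revisited*, Acta Arith. 96 (2000) §3 (3.3). [GranvilleMollin2000]
* H. L. Montgomery, R. C. Vaughan, *Multiplicative Number Theory I*, Thm 10.17, Cor. 11.15.
  [MontgomeryVaughan2007]
-/

noncomputable section

open Finset Real Complex

namespace Literature.NumberTheory.LFunctions

namespace SiegelZero

open DirichletCharacter MotohashiDH

/-- The numerical heart of the `α ≥ 19/20` case: Motohashi's exponent on the base `q^{7+4/1000}`
is at most `(89/10)(1 − α)`. [cite: Motohashi1977DeuringHeilbronnII, Theorem p.25] -/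
theorem motohashi_exponent_le {α : ℝ} (hα : 19 / 20 ≤ α) (hα1 : α ≤ 1) :
    (7 + 4 * (1 / 1000 : ℝ)) * exponent (1 / 100) α ≤ 89 / 10 * (1 - α) := by
  unfold exponent
  have h3 : (17 : ℝ) / 20 ≤ 3 * α - 2 := by linarith
  have h3pos : 0 < 3 * α - 2 := by linarith
  rw [mul_div_assoc', div_le_iff₀ h3pos]
  have h1 : 0 ≤ 1 - α := by linarith
  nlinarith [mul_nonneg h1 (show (0:ℝ) ≤ 3 * α - 2 - 17 / 20 by linarith)]

/-- **Theorem J from Motohashi 1977 (II).** With `θ₁ = 1/1000`, `a = 89/10`: if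
`motohashi1977_theoremII` holds then there are `λ* > 0`, `K_J ≥ 0`, `q_J` such that for every primitive
quadratic `χ` mod `q ≥ q_J`, every real zero `β₁ ≥ 1 − λ*/log q` of `L(s, χ)` and every
`1/2 ≤ α ≤ 1`, `N(α, q^{θ₁}; χ, {β₁}) ≤ K_J ((1 − β₁) log q) q^{a(1−α)}` — the hypothesis of
`GranvilleMollin2000_eq33_of_dhDensity`, for ALL ranges of `1 − β₁` (Siegel's theorem supplies the
range `α < 19/20`). [cite: Motohashi1977DeuringHeilbronnII, Theorem p.25]
[cite: MontgomeryVaughan2007, Theorem 10.17 and Corollary 11.15] -/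
theorem theoremJ_of_motohashi (hM : motohashi1977_theoremII) :
    ∃ lamStar θ₁ a KJ qJ : ℝ, 0 < lamStar ∧ 0 < θ₁ ∧ θ₁ ≤ 1 ∧ 0 ≤ a ∧ a < 9 ∧ 0 ≤ KJ ∧
      ∀ (q : ℕ) [NeZero q] (χ : DirichletCharacter ℂ q), χ.IsPrimitive → χ.IsQuadratic →
        qJ ≤ (q : ℝ) → ∀ β₁ : ℝ, χ.LFunction β₁ = 0 → 1 - lamStar / Real.log q ≤ β₁ →
          ∀ α : ℝ, 1 / 2 ≤ α → α ≤ 1 →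
            charZeroCount χ α ((q : ℝ) ^ θ₁) {(β₁ : ℂ)} ≤
              KJ * ((1 - β₁) * Real.log q) * (q : ℝ) ^ (a * (1 - α)) := by
  classical
  obtain ⟨c₀, hc₀, C, hC, hMq⟩ := hM (1 / 100) (by norm_num)
  obtain ⟨C₀, hC₀, hbox⟩ := exists_boxCount_le_of_le
  obtain ⟨CS, hCS, hSiegel⟩ :=
    Literature.NumberTheory.LFunctions.Siegel.exists_one_sub_realZero_ge (ε := 1 / 40) (by norm_num)
  obtain ⟨KJ, hKJ⟩ : ∃ K : ℝ, K = C * (1 + 1 / 1000) + C₀ / CS := ⟨_, rfl⟩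
  have hKJ0 : 0 ≤ KJ := by rw [hKJ]; positivity
  have hKJ1 : C * (1 + 1 / 1000) ≤ KJ := by rw [hKJ]; exact le_add_of_nonneg_right (by positivity)
  have hKJ2 : C₀ / CS ≤ KJ := by rw [hKJ]; exact le_add_of_nonneg_left (by positivity)
  refine ⟨c₀, 1 / 1000, 89 / 10, KJ, Real.exp 2000, hc₀, by norm_num, by norm_num, by norm_num,
    by norm_num, hKJ0, ?_⟩
  intro q _ χ hprim hquad hq β₁ hβ₁ hlo α hα hα1
  /- sizes -/
  have hq7 : (7 : ℝ) ≤ q := by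
    have h1 : (7 : ℝ) ≤ Real.exp 2000 := by have := Real.add_one_le_exp (2000 : ℝ); linarith
    exact h1.trans hq
  have hq0 : (0 : ℝ) < q := by linarith
  have hq1 : (1 : ℝ) ≤ q := by linarith
  have hq1n : 1 < q := by exact_mod_cast (show (1 : ℝ) < q by linarith)
  obtain ⟨L, hLdef⟩ : ∃ L : ℝ, L = Real.log q := ⟨_, rfl⟩
  have hL2000 : 2000 ≤ L := by
    rw [hLdef, ← Real.log_exp 2000]; exact Real.log_le_log (Real.exp_pos _) hq
  have hL0 : 0 < L := by linarith
  have hχ1 : χ ≠ 1 := by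
    intro h
    have : χ.conductor = 1 := by rw [h, DirichletCharacter.conductor_one]
    rw [hprim] at this
    omega
  have hχ2 : χ ^ 2 = 1 := hquad.sq_eq_one
  -- Siegel: `CS q^{-1/40} ≤ 1 - β₁`, in particular `β₁ < 1`
  have hS : CS * (q : ℝ) ^ (-(1 / 40 : ℝ)) ≤ 1 - β₁ := hSiegel q χ hχ2 hχ1 β₁ hβ₁
  have hqpow0 : 0 < (q : ℝ) ^ (-(1 / 40 : ℝ)) := Real.rpow_pos_of_pos hq0 _
  have h1β₁ : 0 < 1 - β₁ := lt_of_lt_of_le (mul_pos hCS hqpow0) hS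
  have hβ₁1 : β₁ < 1 := by linarith
  /- the height `T = q^{1/1000}` -/
  obtain ⟨T, hT⟩ : ∃ T : ℝ, T = (q : ℝ) ^ (1 / 1000 : ℝ) := ⟨_, rfl⟩
  have hTexp : T = Real.exp (L / 1000) := by
    rw [hT, Real.rpow_def_of_pos hq0, hLdef]; ring_nf
  have hT6 : 6 ≤ T := by
    rw [hTexp]; exact six_le_exp_two.trans (Real.exp_le_exp.2 (by linarith))
  have hT1 : 1 ≤ T := by linarith
  have hT0 : 0 < T := by linarith
  have hTq : T ≤ q := by
    rw [hT]
    calc (q : ℝ) ^ (1 / 1000 : ℝ) ≤ (q : ℝ) ^ (1 : ℝ) :=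
          Real.rpow_le_rpow_of_exponent_le hq1 (by norm_num)
      _ = q := Real.rpow_one _
  rw [← hT]
  have hqa : (q : ℝ) ^ (89 / 10 * (1 - α)) = Real.exp (89 / 10 * (1 - α) * L) := by
    rw [Real.rpow_def_of_pos hq0, ← hLdef]; ring_nf
  rcases le_or_gt (19 / 20 : ℝ) α with hbig | hsmall
  · /- Case `α ≥ 19/20`: Motohashi -/
    have hα34 : (3 : ℝ) / 4 < α := by linarith
    have hMain := hMq q χ hχ1 hquad hprim β₁ (by exact_mod_cast hβ₁)
      (by rw [← hLdef]; rw [← hLdef] at hlo; exact hlo) hβ₁1 T hT1 α hα34 hα1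
    -- rewrite the right-hand side of Motohashi's bound in terms of `L`
    have hlogqT : Real.log ((q : ℝ) * T) = (1 + 1 / 1000) * L := by
      rw [Real.log_mul hq0.ne' hT0.ne', hTexp, Real.log_exp, ← hLdef]; ring
    have hbase : (q : ℝ) ^ (7 : ℕ) * T ^ (4 : ℕ) = Real.exp ((7 + 4 * (1 / 1000)) * L) := by
      have hq' : (q : ℝ) = Real.exp L := by rw [hLdef, Real.exp_log hq0]
      rw [hTexp]
      conv_lhs => rw [hq']
      rw [← Real.exp_nat_mul, ← Real.exp_nat_mul, ← Real.exp_add]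
      push_cast; ring_nf
    have hpow : ((q : ℝ) ^ (7 : ℕ) * T ^ (4 : ℕ)) ^ exponent (1 / 100) α
        ≤ Real.exp (89 / 10 * (1 - α) * L) := by
      rw [hbase, ← Real.exp_mul]
      refine Real.exp_le_exp.2 ?_
      have hexp := motohashi_exponent_le hbig hα1
      have := mul_le_mul_of_nonneg_right hexp hL0.le
      nlinarith [this]
    have hexp0 : 0 ≤ ((q : ℝ) ^ (7 : ℕ) * T ^ (4 : ℕ)) ^ exponent (1 / 100) α :=
      Real.rpow_nonneg (by positivity) _
    calc charZeroCount χ α T {(β₁ : ℂ)}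
        ≤ C * ((1 - β₁) * Real.log ((q : ℝ) * T)) *
            ((q : ℝ) ^ (7 : ℕ) * T ^ (4 : ℕ)) ^ exponent (1 / 100) α := hMain
      _ = C * (1 + 1 / 1000) * ((1 - β₁) * L) *
            ((q : ℝ) ^ (7 : ℕ) * T ^ (4 : ℕ)) ^ exponent (1 / 100) α := by rw [hlogqT]; ring
      _ ≤ KJ * ((1 - β₁) * L) * Real.exp (89 / 10 * (1 - α) * L) := by
            gcongr
      _ = KJ * ((1 - β₁) * Real.log q) * (q : ℝ) ^ (89 / 10 * (1 - α)) := by rw [hqa, hLdef]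
  · /- Case `α < 19/20`: trivial count and Siegel -/
    have hcount : charZeroCount χ α T {(β₁ : ℂ)} ≤ C₀ * T * Real.log q := by
      refine (charZeroCount_le_sum hχ1 α T _).trans ?_
      refine hbox q χ hprim hq1n T hT6 hTq _ fun ρ hρ => ?_
      exact (Set.Finite.mem_toFinset _).1 hρ
    refine hcount.trans ?_
    -- `C₀ T log q ≤ (C₀/CS) (CS q^{-1/40}) q^{1/1000 + 1/40} log q ≤ KJ (1-β₁) log q · q^{a(1-α)}`
    have hTsplit : T = (q : ℝ) ^ (-(1 / 40 : ℝ)) * (q : ℝ) ^ (1 / 1000 + 1 / 40 : ℝ) := by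
      rw [hT, ← Real.rpow_add hq0]; norm_num
    have hqexp_le : (q : ℝ) ^ (1 / 1000 + 1 / 40 : ℝ) ≤ (q : ℝ) ^ (89 / 10 * (1 - α)) :=
      Real.rpow_le_rpow_of_exponent_le hq1 (by linarith)
    have hlogq0 : 0 ≤ Real.log q := by rw [← hLdef]; exact hL0.le
    calc C₀ * T * Real.log q
        = (C₀ / CS) * (CS * (q : ℝ) ^ (-(1 / 40 : ℝ))) * (q : ℝ) ^ (1 / 1000 + 1 / 40 : ℝ) *
            Real.log q := by rw [hTsplit]; field_simp
      _ ≤ KJ * (1 - β₁) * (q : ℝ) ^ (89 / 10 * (1 - α)) * Real.log q := by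
            gcongr
      _ = KJ * ((1 - β₁) * Real.log q) * (q : ℝ) ^ (89 / 10 * (1 - α)) := by ring

/-- **Granville–Mollin (3.3) from Motohashi 1977 (II).** `motohashi1977_theoremII` implies
`Literature.NumberTheory.LFunctions.SiegelZero.GranvilleMollin2000_eq33`.
[cite: GranvilleMollin2000, §3 (3.3)] [cite: Motohashi1977DeuringHeilbronnII, Theorem p.25] -/
theorem GranvilleMollin2000_eq33_of_motohashi (hM : motohashi1977_theoremII) :
    GranvilleMollin2000_eq33 :=
  GranvilleMollin2000_eq33_of_dhDensity (theoremJ_of_motohashi hM)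

end SiegelZero

end Literature.NumberTheory.LFunctions
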